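import Literature.NumberTheory.EllipticCurves.Greenberg1999.TwoTorsionMuInvariant
import Literature.NumberTheory.EllipticCurves.ManinConstantQuadraticTwistAtTwoOrdinaryProofs
import Literature.NumberTheory.EllipticCurves.Rank1Residual.Predicates
import HarnessLib

/-!
# Greenberg's "`Φ` ramified at `2`" on a semistable-at-`2` minimal equation: `v₂(x(P)) = -2` exactly
# (proofs only)

Topic `NumberTheory/EllipticCurves/Greenberg1999`; theorem-only `Proofs`-style companion (no definition,
no named fact, no instance, no `sorry`; D-0014/D-0026) of `TwoTorsionMuInvariant`, which types
R. Greenberg, LNM 1716 (1999), Prop. 5.14 at `p = 2` with the predicate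
`TwoTorsionRamifiedAtTwo x := v₂(x) < 0` ("`P` lies in the kernel of reduction modulo `2`", flag
`Gre99-C2-kernel-of-reduction`) for a rational point `P = (x, y)` of order `2` on a globally minimal
equation.

**The dichotomy is sharp.**  On a globally minimal equation `W/ℚ` with `a₁` ODD — i.e. good ORDINARY or
MULTIPLICATIVE reduction at `2` (`odd_a₁_of_hasGoodReductionAtPrime_two_of_odd_frobeniusTrace_two`,
`odd_a₁_of_hasMultiplicativeReductionAtPrime_two`) — the `2`-division cubic
`4x³ + b₂x² + 2b₄x + b₆` has `b₂` odd, so a rational root `x = n/m` (lowest terms) with `m` even has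
`v₂(m) = 2` exactly: clearing denominators, `4n³ + b₂n²m + 2b₄nm² + b₆m³ = 0` is impossible modulo `4`
if `2 ∥ m` (the term `b₂n²m` is the only one of valuation `1`) and modulo `8` if `8 ∣ m` (then `8 ∣ 4n³`,
`n` even).  Hence `TwoTorsionRamifiedAtTwo x ⟺ v₂(x) = -2`, and otherwise `v₂(x) ≥ 0`
(`padicValRat_eq_neg_two_of_twoTorsionRamifiedAtTwo`, `…_of_goodOrd`, `…_of_mult`).  This is the
`p = 2` shadow of "the kernel of reduction meets `E[2]` in the point with `x`-coordinate of valuation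
`-2`" (Silverman VII.3: `(x, y) ∈ E₁(ℚ₂) ⟺ v(x) < 0`, then `3v(x) = 2v(y)`; for a `2`-torsion point
`2y = -a₁x - a₃` forces `v(x) = -2`).

Written for the BSD cell `bsd-2adic`: the (β) stratum (rational `2`-torsion) of the off-habitat
complement of item 19218 splits into Greenberg's "ramified" (`v₂(x(P)) = -2`) and "unramified"
(`v₂(x(P)) ≥ 0`) sub-strata with no third case.  Nothing about BSD is claimed.

## References

* [GreenbergLNM1716] R. Greenberg, *Iwasawa theory for elliptic curves*, LNM 1716 (1999), §5,
  Prop. 5.14 and the examples pp. 121–122 (chunks p0168–p0176).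
* [SilvermanAEC2009] J. H. Silverman, *The Arithmetic of Elliptic Curves*, 2nd ed., GTM 106 (2009),
  VII.3 (the filtration `E₁`), III.2.3 (points of order `2`), Exercise 8.15(a).
-/

set_option autoImplicit false

open WeierstrassCurve

namespace Literature.NumberTheory.EllipticCurves.Greenberg1999

open Rank1Residual

/-! ### §1. The arithmetic core: a rational root of `4x³ + B₂x² + 2B₄x + B₆`, `B₂` odd -/

/-- **A rational root `x` of `4x³ + B₂x² + 2B₄x + B₆` (`Bᵢ ∈ ℤ`, `B₂` odd) with even denominator has
denominator of `2`-adic valuation exactly `2` and odd numerator**: with `x = n/m` in lowest terms,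
`4n³ + B₂n²m + 2B₄nm² + B₆m³ = 0`; `2 ∥ m` is impossible modulo `4`, `8 ∣ m` is impossible modulo `8`.
[cite: GreenbergLNM1716, §5 examples pp. 121–122 (the point (3/4, -7/8) generating C₂[2])] -/
theorem den_eq_four_mul_odd_of_twoDivision_root {x : ℚ} {B₂ B₄ B₆ : ℤ} (hB₂ : Odd B₂)
    (h : 4 * x ^ 3 + B₂ * x ^ 2 + 2 * B₄ * x + B₆ = 0) (hm : 2 ∣ x.den) :
    ∃ m₂ : ℤ, Odd m₂ ∧ (x.den : ℤ) = 4 * m₂ ∧ Odd x.num := by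
  set n : ℤ := x.num with hn
  set m : ℕ := x.den with hmdef
  have hm0 : (m : ℚ) ≠ 0 := by exact_mod_cast x.den_ne_zero
  have hxm : x * (m : ℚ) = (n : ℚ) := by
    have hx : (n : ℚ) / (m : ℚ) = x := Rat.num_div_den x
    rw [← hx, div_mul_cancel₀ _ hm0]
  -- the integer equation `4n³ + B₂n²m + 2B₄nm² + B₆m³ = 0`
  have hZ : 4 * n ^ 3 + B₂ * n ^ 2 * m + 2 * B₄ * n * (m : ℤ) ^ 2 + B₆ * (m : ℤ) ^ 3 = 0 := by
    have hQ : ((4 * n ^ 3 + B₂ * n ^ 2 * m + 2 * B₄ * n * (m : ℤ) ^ 2 + B₆ * (m : ℤ) ^ 3 : ℤ) : ℚ) =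
        (m : ℚ) ^ 3 * (4 * x ^ 3 + B₂ * x ^ 2 + 2 * B₄ * x + B₆) := by
      push_cast
      rw [← hxm]
      ring
    rw [h, mul_zero] at hQ
    exact_mod_cast hQ
  -- `n` is odd (coprime to the even `m`)
  have hnodd : Odd n := by
    rcases Int.even_or_odd n with he | ho
    · exfalso
      have h2n : 2 ∣ n.natAbs := by
        have : (2 : ℤ) ∣ n := even_iff_two_dvd.mp he
        exact Int.natAbs_dvd_natAbs.mpr this
      have hcop : Nat.Coprime n.natAbs m := x.reduced
      have h22 : Nat.Coprime 2 2 := Nat.Coprime.coprime_dvd_left h2n (hcop.coprime_dvd_right hm)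
      exact absurd ((Nat.coprime_self 2).mp h22) (by norm_num)
    · exact ho
  -- write `m = 2 m₁`
  obtain ⟨m₁', hm₁'⟩ := hm
  set m₁ : ℤ := (m₁' : ℤ) with hm₁def
  have hm₁ : (m : ℤ) = 2 * m₁ := by rw [hm₁def]; exact_mod_cast hm₁'
  rw [hm₁] at hZ
  -- `m₁` is even: otherwise `B₂ n² m₁` would be both odd and even
  have hm₁even : Even m₁ := by
    by_contra hodd
    have hm₁odd : Odd m₁ := Int.not_even_iff_odd.mp hodd
    have hodd3 : Odd (B₂ * n ^ 2 * m₁) := (hB₂.mul (hnodd.pow)).mul hm₁odd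
    have hinner : 2 * (2 * n ^ 3 + B₂ * n ^ 2 * m₁ + 4 * B₄ * n * m₁ ^ 2 + 4 * B₆ * m₁ ^ 3) = 0 := by
      linear_combination hZ
    have hinner' : 2 * n ^ 3 + B₂ * n ^ 2 * m₁ + 4 * B₄ * n * m₁ ^ 2 + 4 * B₆ * m₁ ^ 3 = 0 := by
      rcases mul_eq_zero.mp hinner with h2 | h2
      · exact absurd h2 two_ne_zero
      · exact h2
    have heven3 : Even (B₂ * n ^ 2 * m₁) :=
      ⟨-(n ^ 3 + 2 * B₄ * n * m₁ ^ 2 + 2 * B₆ * m₁ ^ 3), by linear_combination hinner'⟩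
    exact (Int.not_even_iff_odd.mpr hodd3) heven3
  obtain ⟨m₂, hm₂⟩ := hm₁even
  -- `m₂` is odd: otherwise `8 ∣ m`, and `4n³ ≡ 0 (mod 8)` would make `n` even
  have hm₂odd : Odd m₂ := by
    rcases Int.even_or_odd m₂ with ⟨m₃, hm₃⟩ | ho
    · exfalso
      rw [hm₂, hm₃] at hZ
      have h4 : (4 : ℤ) * (n ^ 3 + 2 * B₂ * n ^ 2 * m₃ + 32 * B₄ * n * m₃ ^ 2 + 128 * B₆ * m₃ ^ 3) = 0 := by
        linear_combination hZ
      have h4' : n ^ 3 + 2 * B₂ * n ^ 2 * m₃ + 32 * B₄ * n * m₃ ^ 2 + 128 * B₆ * m₃ ^ 3 = 0 :=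
        (mul_eq_zero.mp h4).resolve_left (by norm_num)
      have hn3 : Even (n ^ 3) :=
        ⟨-(B₂ * n ^ 2 * m₃ + 16 * B₄ * n * m₃ ^ 2 + 64 * B₆ * m₃ ^ 3), by
          linear_combination h4'⟩
      exact (Int.not_even_iff_odd.mpr hnodd) ((Int.even_pow.mp hn3).1)
    · exact ho
  refine ⟨m₂, hm₂odd, ?_, hnodd⟩
  rw [hm₁, hm₂]
  ring

/-- **`v₂(x) = -2` for such a root** (valuation form of the previous lemma: odd numerator, denominator
`4 × odd`). [cite: GreenbergLNM1716, §5 examples pp. 121–122] -/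
theorem padicValRat_eq_neg_two_of_twoDivision_root {x : ℚ} {B₂ B₄ B₆ : ℤ} (hB₂ : Odd B₂)
    (h : 4 * x ^ 3 + B₂ * x ^ 2 + 2 * B₄ * x + B₆ = 0) (hneg : padicValRat 2 x < 0) :
    padicValRat 2 x = -2 := by
  haveI : Fact (Nat.Prime 2) := ⟨Nat.prime_two⟩
  -- `v₂(x) < 0` forces `2 ∣ den x`
  have hm : 2 ∣ x.den := by
    by_contra hnd
    rw [padicValRat_def, padicValNat.eq_zero_of_not_dvd hnd] at hneg
    omega
  obtain ⟨m₂, hm₂odd, hden, hnum⟩ := den_eq_four_mul_odd_of_twoDivision_root hB₂ h hm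
  have hm₂0 : (m₂ : ℚ) ≠ 0 := by
    exact_mod_cast fun h0 ↦ (Int.not_even_iff_odd.mpr hm₂odd) (by simp [h0])
  have hn0 : (x.num : ℚ) ≠ 0 := by
    exact_mod_cast fun h0 ↦ (Int.not_even_iff_odd.mpr hnum) (by simp [h0])
  have hx : x = (x.num : ℚ) / (4 * (m₂ : ℚ)) := by
    have h1 : (x.num : ℚ) / (x.den : ℚ) = x := Rat.num_div_den x
    have h2 : ((x.den : ℤ) : ℚ) = 4 * (m₂ : ℚ) := by exact_mod_cast hden
    rw [← h2]
    exact_mod_cast h1.symm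
  have hvn : padicValRat 2 (x.num : ℚ) = 0 := by
    rw [padicValRat.of_int, padicValInt.eq_zero_of_not_dvd
      (by simpa [even_iff_two_dvd] using Int.not_even_iff_odd.mpr hnum)]
    simp
  have hvm₂ : padicValRat 2 (m₂ : ℚ) = 0 := by
    rw [padicValRat.of_int, padicValInt.eq_zero_of_not_dvd
      (by simpa [even_iff_two_dvd] using Int.not_even_iff_odd.mpr hm₂odd)]
    simp
  have hv4 : padicValRat 2 (4 : ℚ) = 2 := by
    rw [show (4 : ℚ) = ((2 : ℕ) : ℚ) ^ 2 by norm_num, padicValRat.pow, padicValRat.self one_lt_two]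
    norm_num
  rw [hx, padicValRat.div hn0 (mul_ne_zero (by norm_num) hm₂0), padicValRat.mul (by norm_num) hm₂0,
    hvn, hv4, hvm₂]
  norm_num

/-- **Otherwise `v₂(x) ≥ 0`**: for such a root, `v₂(x) < 0 ⟹ v₂(x) = -2`, so the only values are
`-2` and `≥ 0` (Greenberg's "ramified at 2" / "not ramified at 2" dichotomy is between `v₂ = -2` and
`v₂ ≥ 0`). [cite: GreenbergLNM1716, §5 (chunk p0168) and Prop. 5.14] -/
theorem padicValRat_eq_neg_two_or_nonneg_of_twoDivision_root {x : ℚ} {B₂ B₄ B₆ : ℤ} (hB₂ : Odd B₂)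
    (h : 4 * x ^ 3 + B₂ * x ^ 2 + 2 * B₄ * x + B₆ = 0) :
    padicValRat 2 x = -2 ∨ 0 ≤ padicValRat 2 x := by
  by_cases hneg : padicValRat 2 x < 0
  · exact Or.inl (padicValRat_eq_neg_two_of_twoDivision_root hB₂ h hneg)
  · exact Or.inr (not_lt.mp hneg)

/-! ### §2. On a globally minimal equation with `a₁` odd (good ordinary or multiplicative at `2`) -/

section Minimal

variable (W : WeierstrassCurve ℚ) [W.IsElliptic] [W.IsGloballyMinimal]

omit [W.IsElliptic] in
/-- The `2`-division cubic of `W` is that of its integral model read in `ℚ` (`b₂, b₄, b₆ ∈ ℤ`).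
[cite: SilvermanAEC2009, III.1 and VIII.8 (the minimal equation has integral coefficients)] -/
theorem b₂_b₄_b₆_eq_intCast :
    W.b₂ = ((integralModelInt W).b₂ : ℚ) ∧ W.b₄ = ((integralModelInt W).b₄ : ℚ) ∧
      W.b₆ = ((integralModelInt W).b₆ : ℚ) := by
  have h₂ := (integralModelInt W).map_b₂ (Int.castRingHom ℚ)
  have h₄ := (integralModelInt W).map_b₄ (Int.castRingHom ℚ)
  have h₆ := (integralModelInt W).map_b₆ (Int.castRingHom ℚ)
  rw [map_integralModelInt, eq_intCast] at h₂ h₄ h₆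
  exact ⟨h₂, h₄, h₆⟩

omit [W.IsElliptic] in
/-- `a₁` odd ⟹ `b₂ = a₁² + 4a₂` odd (integral model). [cite: SilvermanAEC2009, Exercise 8.15(a)] -/
theorem odd_b₂_integralModelInt_of_odd_a₁ (h : Odd (integralModelInt W).a₁) :
    Odd (integralModelInt W).b₂ := by
  have hb : (integralModelInt W).b₂ = (integralModelInt W).a₁ ^ 2 + 4 * (integralModelInt W).a₂ := rfl
  rw [hb]
  exact (h.pow).add_even ⟨2 * (integralModelInt W).a₂, by ring⟩

omit [W.IsElliptic] in
/-- **`a₁` odd ⟹ a RAMIFIED rational `2`-torsion abscissa has `v₂(x) = -2`, an unramified one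
`v₂(x) ≥ 0`.** [cite: GreenbergLNM1716, §5 (chunk p0168) and Prop. 5.14] [cite: SilvermanAEC2009, VII.3 and III.2.3] -/
theorem padicValRat_eq_neg_two_or_nonneg_of_hasRationalTwoTorsionX_of_odd_a₁
    (ha₁ : Odd (integralModelInt W).a₁) {x : ℚ} (hx : HasRationalTwoTorsionX W x) :
    padicValRat 2 x = -2 ∨ 0 ≤ padicValRat 2 x := by
  obtain ⟨y, hEq, h2⟩ := hx
  have hcubic := fourXCubed_add_eq_zero_of_twoTorsion hEq h2
  obtain ⟨h₂, h₄, h₆⟩ := b₂_b₄_b₆_eq_intCast W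
  rw [h₂, h₄, h₆] at hcubic
  exact padicValRat_eq_neg_two_or_nonneg_of_twoDivision_root
    (odd_b₂_integralModelInt_of_odd_a₁ W ha₁) hcubic

/-- **At a good ORDINARY `2`: `TwoTorsionRamifiedAtTwo x ⟹ v₂(x) = -2`** for every rational `2`-torsion
abscissa `x` of the minimal equation — Greenberg's "`Φ = ⟨P⟩` ramified at `2`" pinned to the value
`-2`. [cite: GreenbergLNM1716, Prop. 5.14 (chunk p0170) and §5 (chunk p0168)] -/
theorem padicValRat_eq_neg_two_of_twoTorsionRamifiedAtTwo_of_goodOrd (hgo : GoodOrd W 2) {x : ℚ}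
    (hx : HasRationalTwoTorsionX W x) (hram : TwoTorsionRamifiedAtTwo x) : padicValRat 2 x = -2 := by
  have hodd : Odd (W.frobeniusTrace 2) := by
    rcases Int.even_or_odd (W.frobeniusTrace 2) with he | ho
    · exact absurd (even_iff_two_dvd.mp he) hgo.2
    · exact ho
  have ha₁ := odd_a₁_of_hasGoodReductionAtPrime_two_of_odd_frobeniusTrace_two W hgo.1 hodd
  rcases padicValRat_eq_neg_two_or_nonneg_of_hasRationalTwoTorsionX_of_odd_a₁ W ha₁ hx with h | h
  · exact h
  · exact absurd hram (not_lt.mpr h)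

/-- **At a good ORDINARY `2`: a rational `2`-torsion abscissa has `v₂(x) = -2` (ramified) or `v₂(x) ≥ 0`
(unramified)** — no third case. [cite: GreenbergLNM1716, Prop. 5.14 (chunk p0170) and §5 (chunk p0168)] -/
theorem padicValRat_eq_neg_two_or_nonneg_of_goodOrd (hgo : GoodOrd W 2) {x : ℚ}
    (hx : HasRationalTwoTorsionX W x) : padicValRat 2 x = -2 ∨ 0 ≤ padicValRat 2 x := by
  have hodd : Odd (W.frobeniusTrace 2) := by
    rcases Int.even_or_odd (W.frobeniusTrace 2) with he | ho
    · exact absurd (even_iff_two_dvd.mp he) hgo.2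
    · exact ho
  exact padicValRat_eq_neg_two_or_nonneg_of_hasRationalTwoTorsionX_of_odd_a₁ W
    (odd_a₁_of_hasGoodReductionAtPrime_two_of_odd_frobeniusTrace_two W hgo.1 hodd) hx

/-- **At a MULTIPLICATIVE `2`: `TwoTorsionRamifiedAtTwo x ⟹ v₂(x) = -2`** (`a₁` odd on the minimal
equation, `odd_a₁_of_hasMultiplicativeReductionAtPrime_two`).
[cite: GreenbergLNM1716, Prop. 5.14 (the multiplicative case) and §5 (chunk p0168)] -/
theorem padicValRat_eq_neg_two_of_twoTorsionRamifiedAtTwo_of_mult (hm : Mult W 2) {x : ℚ}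
    (hx : HasRationalTwoTorsionX W x) (hram : TwoTorsionRamifiedAtTwo x) : padicValRat 2 x = -2 := by
  have ha₁ := odd_a₁_of_hasMultiplicativeReductionAtPrime_two W hm
  rcases padicValRat_eq_neg_two_or_nonneg_of_hasRationalTwoTorsionX_of_odd_a₁ W ha₁ hx with h | h
  · exact h
  · exact absurd hram (not_lt.mpr h)

end Minimal

end Literature.NumberTheory.EllipticCurves.Greenberg1999
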